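import Summits.Ventures.PercRepro.RankLevelSetHCore

/-!
# PercRepro — Theorem N, piece (N4): the pair weighting on the lines of a simple matroid (p2, gen 5)

`proofs/MINE2-RLS.md` §14 Step 2 in the no-truncation form of §15.2, for a finite SIMPLE matroid `M`
(`ThmH.Simple`: two distinct points of the ground set have rank `2`) and a parameter `p`:

* a pair `{a, b}` is COINDEPENDENT if `ρ(E ∖ {a, b}) ≥ p`; a trace `S ∩ L` of a line `L` is ELIGIBLE if it has at
  least two points and contains a coindependent pair (`Elig M p L`);
* `S ∈ Y′ := {S ⊆ E : 2 < ρ(S) < p}` pays the line `L` the weight `w(L, S) = C(|S ∩ L|, 2) / C(|S|, 2)` when its trace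
  is eligible, `0` otherwise; `supply(L) := Σ_{S ∈ Y′} w(L, S)`.

Proved here (nothing beyond `Simple` is assumed):
* `sum_trace_choose_le` — `Σ_L C(|S ∩ L|, 2) ≤ C(|S|, 2)` (every pair of points lies on at most one line), hence
  `sum_w_le_one : Σ_L w(L, S) ≤ 1` and `sum_supply_le : Σ_L supply(L) ≤ #Y′`;
* `card_Up_le` — `U′ := {B ⊆ E : ρ(B) = 2, ρ(E ∖ B) ≥ p}` injects into `⊔_L U′_L`, `U′_L := {B ⊆ L : |B| ≥ 2, ρ(E ∖ B) ≥ p}`;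
* `UpL_subset_Elig` — every member of `U′_L` is an eligible trace;
* `supply_ge` — `supply(L) ≥ Σ_{B′ ∈ Elig(L)} F_{n′}(|B′|)` with `n′ = |E ∖ L|` and
  `F_n(b) = Σ_{x=1}^{p−3} C(n, x)·C(b, 2)/C(b + x, 2)`, by the witnesses `(B′, X) ↦ B′ ∪ X` (`X ⊆ E ∖ L`,
  `1 ≤ |X| ≤ p − 3`) whose rank lies in `[3, p − 1]` — no contraction is needed: `≥ 3` from one point off the line,
  `≤ 2 + |X|` from submodularity.

The per-line closing `Φ(p,2)·#U′_L ≤ Σ_{B′ ∈ Elig(L)} F_{n′}(|B′|)` (the line types and the binomial layer) is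
piece (N5).  Imports Mathlib and `RankLevelSetHCore` only.
-/

namespace PercRepro

namespace ThmN

open Finset ThmH

variable {α : Type*} [DecidableEq α] {M : Matroid α} [M.Finite]

/-- **(i)** The pairs of `S` lie on at most one line each: `Σ_L C(|S ∩ L|, 2) ≤ C(|S|, 2)`. -/
theorem sum_trace_choose_le (hs : Simple M) (S : Finset α) :
    ∑ L ∈ lines M, (S ∩ L).card.choose 2 ≤ S.card.choose 2 := by
  have h1 : ∑ L ∈ lines M, (S ∩ L).card.choose 2 =
      ((lines M).sigma (fun L => (S ∩ L).powersetCard 2)).card := by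
    rw [Finset.card_sigma]
    simp only [Finset.card_powersetCard]
  rw [h1, ← Finset.card_powersetCard]
  refine Finset.card_le_card_of_injOn (fun q => q.2) ?_ ?_
  · rintro ⟨L, P⟩ hq
    simp only [Finset.mem_coe, Finset.mem_sigma, Finset.mem_powersetCard] at hq ⊢
    exact ⟨hq.2.1.trans Finset.inter_subset_left, hq.2.2⟩
  · rintro ⟨L, P⟩ hq ⟨L', P'⟩ hq' hPP
    simp only at hPP
    subst hPP
    simp only [Finset.mem_coe, Finset.mem_sigma, Finset.mem_powersetCard] at hq hq'
    obtain ⟨hL, hPL, hP2⟩ := hq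
    obtain ⟨hL', hPL', -⟩ := hq'
    obtain ⟨a, ha, b, hb, hab⟩ := Finset.one_lt_card.1 (show 1 < P.card by omega)
    have hLL : L = L' := lines_eq_of_two_mem hs hL hL' (Finset.mem_inter.1 (hPL ha)).2
      (Finset.mem_inter.1 (hPL hb)).2 (Finset.mem_inter.1 (hPL' ha)).2 (Finset.mem_inter.1 (hPL' hb)).2 hab
    subst hLL
    rfl

/-- A coindependent pair: `ρ(E ∖ {a, b}) ≥ p`. -/
def Coindep (M : Matroid α) [M.Finite] (p : ℕ) (a b : α) : Prop :=
  ((p : ℕ) : ℕ∞) ≤ M.eRk ((gr M \ {a, b} : Finset α) : Set α)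

open scoped Classical in
/-- The eligible subsets of a line `L`: at least two points and a coindependent pair. -/
noncomputable def Elig (M : Matroid α) [M.Finite] (p : ℕ) (L : Finset α) : Finset (Finset α) :=
  L.powerset.filter (fun B => 2 ≤ B.card ∧ ∃ a ∈ B, ∃ b ∈ B, a ≠ b ∧ Coindep M p a b)

open scoped Classical in
/-- The weight `S` pays the line `L`. -/
noncomputable def w (M : Matroid α) [M.Finite] (p : ℕ) (L S : Finset α) : ℚ :=
  if S ∩ L ∈ Elig M p L then ((S ∩ L).card.choose 2 : ℚ) / (S.card.choose 2 : ℚ) else 0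

/-- The weights are nonnegative. -/
theorem w_nonneg (M : Matroid α) [M.Finite] (p : ℕ) (L S : Finset α) : 0 ≤ w M p L S := by
  unfold w
  split_ifs
  · positivity
  · exact le_refl _

/-- `Σ_L w(L, S) ≤ 1`. -/
theorem sum_w_le_one (hs : Simple M) (p : ℕ) (S : Finset α) : ∑ L ∈ lines M, w M p L S ≤ 1 := by
  classical
  have hle : ∑ L ∈ lines M, w M p L S ≤
      ∑ L ∈ lines M, ((S ∩ L).card.choose 2 : ℚ) / (S.card.choose 2 : ℚ) := by
    apply Finset.sum_le_sum
    intro L _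
    unfold w
    split_ifs
    · exact le_refl _
    · positivity
  refine hle.trans ?_
  rw [← Finset.sum_div]
  rcases Nat.eq_zero_or_pos (S.card.choose 2) with h0 | hpos
  · rw [h0]; simp
  · rw [div_le_one (by exact_mod_cast hpos)]
    exact_mod_cast sum_trace_choose_le hs S

open scoped Classical in
/-- `Y′ = {S ⊆ E : 2 < ρ(S) < p}`. -/
noncomputable def Yp (M : Matroid α) [M.Finite] (p : ℕ) : Finset (Finset α) :=
  (gr M).powerset.filter (fun S => 2 < M.eRk (S : Set α) ∧ M.eRk (S : Set α) < ((p : ℕ) : ℕ∞))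

/-- The supply of a line: the total weight it receives from `Y′`. -/
noncomputable def supply (M : Matroid α) [M.Finite] (p : ℕ) (L : Finset α) : ℚ :=
  ∑ S ∈ Yp M p, w M p L S

/-- **(ii)** `Σ_L supply(L) ≤ #Y′`. -/
theorem sum_supply_le (hs : Simple M) (p : ℕ) :
    ∑ L ∈ lines M, supply M p L ≤ ((Yp M p).card : ℚ) := by
  unfold supply
  rw [Finset.sum_comm]
  calc ∑ S ∈ Yp M p, ∑ L ∈ lines M, w M p L S ≤ ∑ S ∈ Yp M p, (1 : ℚ) :=
        Finset.sum_le_sum (fun S _ => sum_w_le_one hs p S)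
    _ = (Yp M p).card := by simp

open scoped Classical in
/-- `U′ = {B ⊆ E : ρ(B) = 2, ρ(E ∖ B) ≥ p}` (the rank-2 side of `U(p, 2)`, no truncation). -/
noncomputable def Up (M : Matroid α) [M.Finite] (p : ℕ) : Finset (Finset α) :=
  (gr M).powerset.filter (fun B => M.eRk (B : Set α) = 2 ∧ ((p : ℕ) : ℕ∞) ≤ M.eRk ((gr M \ B : Finset α) : Set α))

open scoped Classical in
/-- `U′_L = {B ⊆ L : |B| ≥ 2, ρ(E ∖ B) ≥ p}`. -/
noncomputable def UpL (M : Matroid α) [M.Finite] (p : ℕ) (L : Finset α) : Finset (Finset α) :=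
  L.powerset.filter (fun B => 2 ≤ B.card ∧ ((p : ℕ) : ℕ∞) ≤ M.eRk ((gr M \ B : Finset α) : Set α))

/-- **(iii)** `#U′ ≤ Σ_L #U′_L` (`B ↦ (cl B, B)`). -/
theorem card_Up_le (M : Matroid α) [M.Finite] (p : ℕ) : (Up M p).card ≤ ∑ L ∈ lines M, (UpL M p L).card := by
  classical
  rw [← Finset.card_sigma]
  refine Finset.card_le_card_of_injOn (fun B => (⟨clF M B, B⟩ : Σ _ : Finset α, Finset α)) ?_ ?_
  · intro B hB
    simp only [Finset.mem_coe, Up, Finset.mem_filter, Finset.mem_powerset] at hB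
    obtain ⟨hBE, hB2, hBp⟩ := hB
    obtain ⟨hline, hBcl⟩ := clF_mem_lines hBE hB2
    simp only [Finset.mem_coe, Finset.mem_sigma, UpL, Finset.mem_filter, Finset.mem_powerset]
    refine ⟨hline, hBcl, ?_, hBp⟩
    have h := M.eRk_le_encard (B : Set α)
    rw [hB2, Set.encard_coe_eq_coe_finsetCard] at h
    exact_mod_cast h
  · intro B _ B' _ h
    have := congrArg Sigma.snd h
    simpa using this

/-- **(iv)** Every member of `U′_L` is an eligible trace (each of its pairs is coindependent). -/
theorem UpL_subset_Elig (M : Matroid α) [M.Finite] (p : ℕ) (L : Finset α) : UpL M p L ⊆ Elig M p L := by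
  intro B hB
  simp only [UpL, Finset.mem_filter, Finset.mem_powerset] at hB
  obtain ⟨hBL, hB2, hBp⟩ := hB
  simp only [Elig, Finset.mem_filter, Finset.mem_powerset]
  refine ⟨hBL, hB2, ?_⟩
  obtain ⟨a, ha, b, hb, hab⟩ := Finset.one_lt_card.1 (show 1 < B.card by omega)
  refine ⟨a, ha, b, hb, hab, ?_⟩
  unfold Coindep
  refine hBp.trans (M.eRk_mono ?_)
  apply Finset.coe_subset.2
  apply Finset.sdiff_subset_sdiff (subset_refl _)
  intro x hx
  simp only [Finset.mem_insert, Finset.mem_singleton] at hx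
  rcases hx with rfl | rfl <;> assumption

/-- `F_n(b) = Σ_{x=1}^{p−3} C(n, x)·C(b, 2)/C(b + x, 2)`. -/
noncomputable def Fn (p n b : ℕ) : ℚ :=
  ∑ x ∈ Finset.Ico 1 (p - 2), (n.choose x : ℚ) * (b.choose 2 : ℚ) / ((b + x).choose 2 : ℚ)

open scoped Classical in
/-- The witnesses of a line: pairs `(B′, X)` with `B′ ∈ Elig(L)`, `X ⊆ E ∖ L`, `1 ≤ |X| ≤ p − 3`. -/
noncomputable def Wit (M : Matroid α) [M.Finite] (p : ℕ) (L : Finset α) : Finset (Σ _ : Finset α, Finset α) :=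
  (Elig M p L).sigma (fun _ => (gr M \ L).powerset.filter (fun X => 1 ≤ X.card ∧ X.card ≤ p - 3))

/-- The set `B′ ∪ X` of a witness. -/
def fW (q : Σ _ : Finset α, Finset α) : Finset α := q.1 ∪ q.2

/-- A witness is a member of `Y′`: its rank lies in `[3, p − 1]`. -/
theorem fW_mem_Yp (hs : Simple M) {p : ℕ} {L : Finset α} (hL : L ∈ lines M)
    {q : Σ _ : Finset α, Finset α} (hq : q ∈ Wit M p L) : fW q ∈ Yp M p := by
  obtain ⟨B, X⟩ := q
  simp only [Wit, Finset.mem_sigma, Elig, Finset.mem_filter, Finset.mem_powerset] at hq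
  obtain ⟨⟨hBL, hB2, -⟩, hXE, hX1, hX3⟩ := hq
  have hLE := (mem_lines.1 hL).1
  simp only [Yp, fW, Finset.mem_filter, Finset.mem_powerset]
  refine ⟨Finset.union_subset (hBL.trans hLE) (hXE.trans Finset.sdiff_subset), ?_, ?_⟩
  · -- rank ≥ 3: one point of X off the line
    obtain ⟨x, hx⟩ := Finset.card_pos.1 (show 0 < X.card by omega)
    have hxE : x ∈ gr M := (Finset.mem_sdiff.1 (hXE hx)).1
    have hxL : x ∉ L := (Finset.mem_sdiff.1 (hXE hx)).2
    have h3 := eRk_insert_eq_three hs hL hBL hB2 hxE hxL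
    have hsub : ((insert x B : Finset α) : Set α) ⊆ ((B ∪ X : Finset α) : Set α) := by
      apply Finset.coe_subset.2
      intro y hy
      rw [Finset.mem_insert] at hy
      rw [Finset.mem_union]
      rcases hy with rfl | hy
      · exact Or.inr hx
      · exact Or.inl hy
    have := M.eRk_mono hsub
    rw [h3] at this
    exact lt_of_lt_of_le (by norm_num) this
  · -- rank ≤ 2 + |X| ≤ p − 1
    have hBr := eRk_eq_two_of_subset_line hs hL hBL hB2
    have h1 := M.eRk_union_le_eRk_add_eRk (B : Set α) (X : Set α)
    rw [hBr] at h1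
    have h2 : M.eRk (X : Set α) ≤ (X.card : ℕ∞) := by
      have := M.eRk_le_encard (X : Set α)
      rwa [Set.encard_coe_eq_coe_finsetCard] at this
    have h3 : M.eRk ((B : Set α) ∪ (X : Set α)) ≤ ((2 + X.card : ℕ) : ℕ∞) := by
      push_cast
      exact h1.trans (add_le_add (le_refl _) h2)
    rw [Finset.coe_union]
    refine lt_of_le_of_lt h3 ?_
    exact_mod_cast (show 2 + X.card < p by omega)

/-- The trace of a witness on its line is `B′`, the rest is `X`, and the witness has `|B′| + |X|` points. -/
theorem fW_inter_line {p : ℕ} {L : Finset α} {q : Σ _ : Finset α, Finset α} (hq : q ∈ Wit M p L) :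
    fW q ∩ L = q.1 ∧ fW q \ L = q.2 ∧ (fW q).card = q.1.card + q.2.card := by
  obtain ⟨B, X⟩ := q
  simp only [Wit, Finset.mem_sigma, Elig, Finset.mem_filter, Finset.mem_powerset] at hq
  obtain ⟨⟨hBL, -, -⟩, hXE, -, -⟩ := hq
  have hXL : ∀ y ∈ X, y ∉ L := fun y hy => (Finset.mem_sdiff.1 (hXE hy)).2
  have hdisj : Disjoint B X := by
    rw [Finset.disjoint_left]
    intro y hyB hyX
    exact hXL y hyX (hBL hyB)
  refine ⟨?_, ?_, ?_⟩
  · ext y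
    simp only [fW, Finset.mem_inter, Finset.mem_union]
    constructor
    · rintro ⟨hy | hy, hyL⟩
      · exact hy
      · exact absurd hyL (hXL y hy)
    · intro hy
      exact ⟨Or.inl hy, hBL hy⟩
  · ext y
    simp only [fW, Finset.mem_sdiff, Finset.mem_union]
    constructor
    · rintro ⟨hy | hy, hyL⟩
      · exact absurd (hBL hy) hyL
      · exact hy
    · intro hy
      exact ⟨Or.inr hy, hXL y hy⟩
  · simp only [fW]
    exact Finset.card_union_of_disjoint hdisj

/-- The witness map is injective on `Wit`. -/
theorem fW_injOn (p : ℕ) (L : Finset α) :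
    Set.InjOn fW (Wit M p L : Set (Σ _ : Finset α, Finset α)) := by
  intro q hq q' hq' h
  rw [Finset.mem_coe] at hq hq'
  obtain ⟨h1, h2, -⟩ := fW_inter_line hq
  obtain ⟨h1', h2', -⟩ := fW_inter_line hq'
  have hB : q.1 = q'.1 := by rw [← h1, ← h1', h]
  have hX : q.2 = q'.2 := by rw [← h2, ← h2', h]
  exact Sigma.ext hB (heq_of_eq hX)

/-- The weight a witness pays its line: `C(|B′|, 2) / C(|B′| + |X|, 2)`. -/
theorem w_fW {p : ℕ} {L : Finset α} {q : Σ _ : Finset α, Finset α} (hq : q ∈ Wit M p L) :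
    w M p L (fW q) = (q.1.card.choose 2 : ℚ) / ((q.1.card + q.2.card).choose 2 : ℚ) := by
  classical
  obtain ⟨h1, -, h2⟩ := fW_inter_line hq
  have hB : q.1 ∈ Elig M p L := (Finset.mem_sigma.1 hq).1
  simp only [w]
  rw [h1, h2]
  exact if_pos hB

/-- **(v)** `supply(L) ≥ Σ_{B′ ∈ Elig(L)} F_{|E ∖ L|}(|B′|)`. -/
theorem supply_ge (hs : Simple M) (p : ℕ) {L : Finset α} (hL : L ∈ lines M) :
    ∑ B ∈ Elig M p L, Fn p (gr M \ L).card B.card ≤ supply M p L := by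
  classical
  -- the witnesses inject into Y′ with nonnegative weights
  have h1 : ∑ q ∈ Wit M p L, w M p L (fW q) ≤ supply M p L := by
    unfold supply
    rw [← Finset.sum_image (fW_injOn p L)]
    apply Finset.sum_le_sum_of_subset_of_nonneg
    · intro S hS
      rw [Finset.mem_image] at hS
      obtain ⟨q, hq, rfl⟩ := hS
      exact fW_mem_Yp hs hL hq
    · intro S _ _
      exact w_nonneg M p L S
  refine le_trans ?_ h1
  -- evaluate the witness sum line by line
  rw [Finset.sum_congr rfl (fun q hq => w_fW hq)]
  rw [Wit, Finset.sum_sigma]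
  apply Finset.sum_le_sum
  intro B _
  -- Σ_X C(b,2)/C(b+|X|,2) over the admissible X, grouped by |X|
  rw [Fn]
  have hmaps : ∀ X ∈ (gr M \ L).powerset.filter (fun X => 1 ≤ X.card ∧ X.card ≤ p - 3),
      X.card ∈ Finset.Ico 1 (p - 2) := by
    intro X hX
    rw [Finset.mem_filter] at hX
    rw [Finset.mem_Ico]
    omega
  rw [← Finset.sum_fiberwise_of_maps_to' hmaps (fun x => (B.card.choose 2 : ℚ) / ((B.card + x).choose 2 : ℚ))]
  apply le_of_eq
  apply Finset.sum_congr rfl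
  intro x hx
  rw [Finset.mem_Ico] at hx
  rw [Finset.sum_const, nsmul_eq_mul]
  have hcard : ((gr M \ L).powerset.filter (fun X => 1 ≤ X.card ∧ X.card ≤ p - 3)).filter
      (fun X => X.card = x) = (gr M \ L).powersetCard x := by
    rw [Finset.powersetCard_eq_filter, Finset.filter_filter]
    apply Finset.filter_congr
    intro X _
    constructor
    · exact fun h => h.2
    · intro h; exact ⟨⟨by omega, by omega⟩, h⟩
  rw [hcard, Finset.card_powersetCard]
  ring

/-- **(N4) assembled**: if every line satisfies the closing inequality `c·#U′_L ≤ Σ_{B′ ∈ Elig(L)} F_{n′}(|B′|)`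
(piece (N5), with `c = Φ(p, 2)`), then `c·#U′ ≤ #Y′`. -/
theorem mul_card_Up_le_of_perLine (hs : Simple M) (p : ℕ) {c : ℚ} (hc : 0 ≤ c)
    (hline : ∀ L ∈ lines M,
      c * ((UpL M p L).card : ℚ) ≤ ∑ B ∈ Elig M p L, Fn p (gr M \ L).card B.card) :
    c * ((Up M p).card : ℚ) ≤ ((Yp M p).card : ℚ) := by
  calc c * ((Up M p).card : ℚ) ≤ c * ((∑ L ∈ lines M, (UpL M p L).card : ℕ) : ℚ) := by
        apply mul_le_mul_of_nonneg_left _ hc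
        exact_mod_cast card_Up_le M p
    _ = ∑ L ∈ lines M, c * ((UpL M p L).card : ℚ) := by
        push_cast
        rw [Finset.mul_sum]
    _ ≤ ∑ L ∈ lines M, ∑ B ∈ Elig M p L, Fn p (gr M \ L).card B.card :=
        Finset.sum_le_sum (fun L hL => hline L hL)
    _ ≤ ∑ L ∈ lines M, supply M p L := Finset.sum_le_sum (fun L hL => supply_ge hs p hL)
    _ ≤ ((Yp M p).card : ℚ) := sum_supply_le hs p

end ThmN

end PercRepro
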